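import Literature.Analysis.Matrix.SignatureTwoOneEigenvector
import Mathlib.Analysis.Matrix.Spectrum
import Mathlib.LinearAlgebra.Matrix.ToLin
import HarnessLib

/-!
# Signature `(2, 1)` from a minority vector

Topic `Analysis/Matrix`; namespace `Literature.Analysis.Matrix`.  Theorems only; no named fact,
no `sorry`.  The bridge from the metric-free description of even zero circles used in the tree
(`Literature.Geometry.Symplectic.IsMinorityVector`: a vector `w` with `S(w, w) ≠ 0` satisfying
the reverse Cauchy–Schwarz inequality `S(w, w) S(v, v) ≤ S(w, v)²` for all `v`) to the spectral
description used by `NegativeEigenvectorSmooth.lean`: for a real symmetric NON-DEGENERATE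
`3 × 3` matrix `T` with a NEGATIVE minority vector `w`,

* `pos_of_orthogonal_of_minority` — `T` is positive definite on the `T`-orthogonal complement
  `{v | ⟨w, T v⟩ = 0}` of `w`;
* `exists_negative_eigenvector_of_minority` — `T` has a unit eigenvector `n` of eigenvalue
  `λ < 0` with `T > 0` on `n^⊥`, i.e. `T` has signature `(2, 1)` (spectral theorem
  `Matrix.IsHermitian.eigenvectorBasis` plus a dimension count).

This is Perutz's remark that the minority cone is the cone around the eigenline `L⁻` of the
signature-`(2,1)` form `S_{ω,g}` (Perutz 2006, §2.3 (d)).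

## References

* T. Perutz, *Zero-sets of near-symplectic forms*, J. Symplectic Geom. 4 (2006), §2.3 (d). [Perutz2006]
-/

noncomputable section

namespace Literature.Analysis.Matrix

open _root_.Matrix Finset

variable {T : Matrix (Fin 3) (Fin 3) ℝ}

/-! ### Positivity on the `T`-orthogonal complement of a negative minority vector -/

/-- **Semi-definiteness from reverse Cauchy–Schwarz**: if `⟨w, T w⟩ < 0` and
`⟨w, T w⟩ ⟨v, T v⟩ ≤ ⟨w, T v⟩²` then `⟨v, T v⟩ ≥ 0` whenever `⟨w, T v⟩ = 0`.
[cite: Perutz2006, §2.3 (d)] -/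
theorem nonneg_of_orthogonal_of_minority {w : Fin 3 → ℝ} (hw : w ⬝ᵥ T *ᵥ w < 0)
    (hcs : ∀ v, (w ⬝ᵥ T *ᵥ w) * (v ⬝ᵥ T *ᵥ v) ≤ (w ⬝ᵥ T *ᵥ v) ^ 2) {v : Fin 3 → ℝ}
    (hv : w ⬝ᵥ T *ᵥ v = 0) : 0 ≤ v ⬝ᵥ T *ᵥ v := by
  have h := hcs v
  rw [hv] at h
  nlinarith

/-- **Positive definiteness on the `T`-orthogonal complement** of a negative minority vector of
a symmetric non-degenerate `T`: an isotropic vector of the (semi-definite) complement would lie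
in its radical, hence be `T`-orthogonal to everything, contradicting non-degeneracy.
[cite: Perutz2006, §2.3 (d)] -/
theorem pos_of_orthogonal_of_minority (hT : T.IsSymm) (hnd : ∀ v, T *ᵥ v = 0 → v = 0)
    {w : Fin 3 → ℝ} (hw : w ⬝ᵥ T *ᵥ w < 0)
    (hcs : ∀ v, (w ⬝ᵥ T *ᵥ w) * (v ⬝ᵥ T *ᵥ v) ≤ (w ⬝ᵥ T *ᵥ v) ^ 2) {v : Fin 3 → ℝ}
    (hv : w ⬝ᵥ T *ᵥ v = 0) (hv0 : v ≠ 0) : 0 < v ⬝ᵥ T *ᵥ v := by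
  refine lt_of_le_of_ne (nonneg_of_orthogonal_of_minority hw hcs hv) fun h0 ↦ hv0 ?_
  -- `v` is isotropic in the semi-definite complement `W`, hence in its radical
  have hrad : ∀ u, w ⬝ᵥ T *ᵥ u = 0 → v ⬝ᵥ T *ᵥ u = 0 := by
    intro u hu
    set a : ℝ := v ⬝ᵥ T *ᵥ u with ha
    set b : ℝ := u ⬝ᵥ T *ᵥ u with hb
    -- `q(t) = ⟨v + t u, T (v + t u)⟩ = 2 t a + t² b ≥ 0` for all `t`
    have hq : ∀ t : ℝ, 0 ≤ 2 * t * a + t ^ 2 * b := by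
      intro t
      have hWt : w ⬝ᵥ T *ᵥ (v + t • u) = 0 := by
        rw [mulVec_add, mulVec_smul, dotProduct_add, dotProduct_smul, hv, hu, smul_zero, add_zero]
      have h1 := nonneg_of_orthogonal_of_minority hw hcs hWt
      have h2 : (v + t • u) ⬝ᵥ T *ᵥ (v + t • u) = 2 * t * a + t ^ 2 * b := by
        rw [mulVec_add, mulVec_smul, add_dotProduct, dotProduct_add, dotProduct_add,
          smul_dotProduct, smul_dotProduct, dotProduct_smul, dotProduct_smul, ← h0,
          dotProduct_mulVec_comm_of_isSymm hT u v, ← ha, ← hb]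
        simp only [smul_eq_mul]; ring
      rw [← h2]; exact h1
    by_contra ha0
    -- take `t = -a / (|b| + 1)`: then `2 t a + t² b < 0`
    have hpos : 0 < |b| + 1 := by positivity
    have h1 := hq (-a / (|b| + 1))
    have h2 : 2 * (-a / (|b| + 1)) * a + (-a / (|b| + 1)) ^ 2 * b =
        a ^ 2 / (|b| + 1) ^ 2 * (b - 2 * (|b| + 1)) := by
      field_simp; ring
    rw [h2] at h1
    have h3 : 0 < a ^ 2 / (|b| + 1) ^ 2 := by positivity
    have h4 : b - 2 * (|b| + 1) < 0 := by linarith [le_abs_self b]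
    nlinarith
  -- hence `T v` pairs to zero with everything: `u = c w + (u - c w)` with `u - c w ∈ W`
  have hall : ∀ u, (T *ᵥ v) ⬝ᵥ u = 0 := by
    intro u
    have hww : w ⬝ᵥ T *ᵥ w ≠ 0 := hw.ne
    set c : ℝ := (w ⬝ᵥ T *ᵥ u) / (w ⬝ᵥ T *ᵥ w) with hc
    have hW : w ⬝ᵥ T *ᵥ (u - c • w) = 0 := by
      rw [mulVec_sub, mulVec_smul, dotProduct_sub, dotProduct_smul, smul_eq_mul, hc,
        div_mul_cancel₀ _ hww, sub_self]
    have h1 := hrad _ hW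
    have hvw : v ⬝ᵥ T *ᵥ w = 0 := by rw [dotProduct_mulVec_comm_of_isSymm hT]; exact hv
    rw [mulVec_sub, mulVec_smul, dotProduct_sub, dotProduct_smul, hvw, smul_zero, sub_zero] at h1
    rw [dotProduct_comm, dotProduct_mulVec_comm_of_isSymm hT]; exact h1
  refine hnd v ?_
  have : (T *ᵥ v) ⬝ᵥ (T *ᵥ v) = 0 := hall _
  exact dotProduct_self_eq_zero.1 this

/-! ### The eigenbasis in `dotProduct` language -/

/-- A real symmetric matrix is Hermitian. [folklore] -/
theorem isHermitian_of_isSymm (hT : T.IsSymm) : T.IsHermitian := by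
  simpa using hT

/-- The eigenvectors of the spectral theorem, as functions `Fin 3 → ℝ`, are `dotProduct`
orthonormal. [folklore] -/
theorem eigenvectorBasis_dotProduct (hH : T.IsHermitian) (i j : Fin 3) :
    (⇑(hH.eigenvectorBasis i) : Fin 3 → ℝ) ⬝ᵥ ⇑(hH.eigenvectorBasis j) =
      if i = j then 1 else 0 := by
  have h := (orthonormal_iff_ite.1 hH.eigenvectorBasis.orthonormal) i j
  rw [EuclideanSpace.inner_eq_star_dotProduct, star_trivial, dotProduct_comm] at h
  exact h

/-- Expansion of a vector in the eigenbasis: `v = ∑ᵢ ⟨v, bᵢ⟩ bᵢ`. [folklore] -/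
theorem sum_dotProduct_eigenvectorBasis_smul (hH : T.IsHermitian) (v : Fin 3 → ℝ) :
    ∑ i, (v ⬝ᵥ ⇑(hH.eigenvectorBasis i)) • (⇑(hH.eigenvectorBasis i) : Fin 3 → ℝ) = v := by
  have h := hH.eigenvectorBasis.sum_repr' (WithLp.toLp 2 v)
  have h' := congrArg WithLp.ofLp h
  rw [WithLp.ofLp_sum] at h'
  simp only [WithLp.ofLp_smul] at h'
  convert h' using 2 with i
  congr 1

/-- **The quadratic form in the eigenbasis**: `⟨v, T v⟩ = ∑ᵢ λᵢ ⟨v, bᵢ⟩²`. [folklore] -/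
theorem quadratic_eq_sum_eigenvalues (hH : T.IsHermitian) (v : Fin 3 → ℝ) :
    v ⬝ᵥ T *ᵥ v = ∑ i, hH.eigenvalues i * (v ⬝ᵥ ⇑(hH.eigenvectorBasis i)) ^ 2 := by
  set b : Fin 3 → Fin 3 → ℝ := fun i ↦ ⇑(hH.eigenvectorBasis i) with hb
  have hexp := sum_dotProduct_eigenvectorBasis_smul hH v
  have hTv : T *ᵥ v = ∑ i, ((v ⬝ᵥ b i) * hH.eigenvalues i) • b i := by
    conv_lhs => rw [← hexp]
    rw [← Matrix.toLin'_apply, map_sum]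
    refine Finset.sum_congr rfl fun i _ ↦ ?_
    rw [map_smul, Matrix.toLin'_apply, hb]
    simp only
    rw [hH.mulVec_eigenvectorBasis i, smul_smul]
  rw [hTv, dotProduct_sum]
  refine Finset.sum_congr rfl fun i _ ↦ ?_
  rw [dotProduct_smul, smul_eq_mul]
  ring

/-! ### Signature `(2, 1)` -/

/-- **Signature `(2,1)` from a negative minority vector.**  A real symmetric non-degenerate
`3 × 3` matrix `T` with a vector `w` such that `⟨w, T w⟩ < 0` and
`⟨w, T w⟩ ⟨v, T v⟩ ≤ ⟨w, T v⟩²` for all `v` (a minority vector, Perutz's cone around `L⁻`) has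
a unit eigenvector `n` of eigenvalue `λ < 0` such that `T` is positive definite on `n^⊥`.
[cite: Perutz2006, §2.3 (d)] -/
theorem exists_negative_eigenvector_of_minority (hT : T.IsSymm) (hnd : ∀ v, T *ᵥ v = 0 → v = 0)
    {w : Fin 3 → ℝ} (hw : w ⬝ᵥ T *ᵥ w < 0)
    (hcs : ∀ v, (w ⬝ᵥ T *ᵥ w) * (v ⬝ᵥ T *ᵥ v) ≤ (w ⬝ᵥ T *ᵥ v) ^ 2) :
    ∃ (n : Fin 3 → ℝ) (lam : ℝ), n ⬝ᵥ n = 1 ∧ T *ᵥ n = lam • n ∧ lam < 0 ∧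
      ∀ v, v ⬝ᵥ n = 0 → v ≠ 0 → 0 < v ⬝ᵥ T *ᵥ v := by
  have hH : T.IsHermitian := isHermitian_of_isSymm hT
  set b : Fin 3 → Fin 3 → ℝ := fun i ↦ ⇑(hH.eigenvectorBasis i) with hb
  set lam : Fin 3 → ℝ := hH.eigenvalues with hlam
  have hbb : ∀ i j, b i ⬝ᵥ b j = if i = j then 1 else 0 := eigenvectorBasis_dotProduct hH
  have hTb : ∀ i, T *ᵥ b i = lam i • b i := fun i ↦ hH.mulVec_eigenvectorBasis i
  have hquad : ∀ v, v ⬝ᵥ T *ᵥ v = ∑ i, lam i * (v ⬝ᵥ b i) ^ 2 :=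
    quadratic_eq_sum_eigenvalues hH
  have hposW := fun v ↦ pos_of_orthogonal_of_minority hT hnd hw hcs (v := v)
  -- (1) some eigenvalue is negative (else `T ≥ 0`, contradicting `⟨w, T w⟩ < 0`)
  have hex : ∃ i, lam i < 0 := by
    by_contra h
    push Not at h
    have : 0 ≤ w ⬝ᵥ T *ᵥ w := by
      rw [hquad]; exact Finset.sum_nonneg fun i _ ↦ mul_nonneg (h i) (sq_nonneg _)
    linarith
  obtain ⟨i₀, hi₀⟩ := hex
  -- (2) at most one eigenvalue is `≤ 0` (else a non-positive eigen-2-plane meets the positive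
  --     2-plane `W = {⟨w, T ·⟩ = 0}`)
  have hothers : ∀ j, j ≠ i₀ → 0 < lam j := by
    intro j hj
    by_contra hle
    push Not at hle
    set φ : (Fin 3 → ℝ) → ℝ := fun u ↦ w ⬝ᵥ T *ᵥ u with hφ
    have hφlin : ∀ (c d : ℝ) (u u' : Fin 3 → ℝ), φ (c • u - d • u') = c * φ u - d * φ u' := by
      intro c d u u'
      simp only [hφ, mulVec_sub, mulVec_smul, dotProduct_sub, dotProduct_smul, smul_eq_mul]
    set v : Fin 3 → ℝ := φ (b j) • b i₀ - φ (b i₀) • b j with hv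
    have hvW : φ v = 0 := by rw [hv, hφlin]; ring
    -- `⟨v, T v⟩ = λ_{i₀} φ(b_j)² + λ_j φ(b_{i₀})² ≤ 0`
    have hvq : v ⬝ᵥ T *ᵥ v = lam i₀ * φ (b j) ^ 2 + lam j * φ (b i₀) ^ 2 := by
      rw [hv, mulVec_sub, mulVec_smul, mulVec_smul, hTb, hTb]
      simp only [sub_dotProduct, dotProduct_sub, smul_dotProduct, dotProduct_smul, smul_eq_mul,
        hbb, if_true, if_neg hj, if_neg (Ne.symm hj)]
      ring
    have hvle : v ⬝ᵥ T *ᵥ v ≤ 0 := by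
      rw [hvq]
      nlinarith [sq_nonneg (φ (b j)), sq_nonneg (φ (b i₀))]
    by_cases hv0 : v = 0
    · -- then `φ(b_j) = φ(b_{i₀}) = 0`, so `b_j ∈ W` with `⟨b_j, T b_j⟩ = λ_j ≤ 0`
      have h1 : φ (b j) = 0 := by
        have h := congrArg (fun x ↦ x ⬝ᵥ b i₀) hv0
        beta_reduce at h
        rw [hv, sub_dotProduct, smul_dotProduct, smul_dotProduct, hbb, hbb, if_pos rfl,
          if_neg hj, zero_dotProduct] at h
        simpa using h
      have h2 : φ (b i₀) = 0 := by
        have h := congrArg (fun x ↦ x ⬝ᵥ b j) hv0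
        beta_reduce at h
        rw [hv, sub_dotProduct, smul_dotProduct, smul_dotProduct, hbb, hbb, if_pos rfl,
          if_neg (Ne.symm hj), zero_dotProduct] at h
        simpa using h
      have hbj0 : b j ≠ 0 := by
        intro h0
        have := hbb j j
        rw [h0, zero_dotProduct, if_pos rfl] at this
        exact zero_ne_one this
      have h3 := hposW (b j) h1 hbj0
      have h4 : b j ⬝ᵥ T *ᵥ b j = lam j := by
        rw [hTb, dotProduct_smul, hbb, if_pos rfl, smul_eq_mul, mul_one]
      linarith
    · have h3 := hposW v hvW hv0
      linarith
  -- (3) the negative unit eigenvector and positivity on its orthogonal complement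
  refine ⟨b i₀, lam i₀, by rw [hbb, if_pos rfl], hTb i₀, hi₀, fun v hv hv0 ↦ ?_⟩
  rw [hquad]
  -- `∑ λᵢ cᵢ² = ∑_{i ≠ i₀} λᵢ cᵢ²` with `c_{i₀} = 0`, positive unless all `cᵢ = 0`
  have hc0 : v ⬝ᵥ b i₀ = 0 := hv
  have hterm : ∀ i, 0 ≤ lam i * (v ⬝ᵥ b i) ^ 2 := by
    intro i
    by_cases hi : i = i₀
    · rw [hi, hc0]; simp
    · exact mul_nonneg (hothers i hi).le (sq_nonneg _)
  refine lt_of_le_of_ne (Finset.sum_nonneg fun i _ ↦ hterm i) fun hsum ↦ hv0 ?_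
  have hall : ∀ i ∈ Finset.univ, lam i * (v ⬝ᵥ b i) ^ 2 = 0 :=
    (Finset.sum_eq_zero_iff_of_nonneg fun i _ ↦ hterm i).1 hsum.symm
  have hci : ∀ i, v ⬝ᵥ b i = 0 := by
    intro i
    by_cases hi : i = i₀
    · rw [hi]; exact hc0
    · have h := hall i (Finset.mem_univ i)
      rcases mul_eq_zero.1 h with h | h
      · exact absurd h (hothers i hi).ne'
      · exact pow_eq_zero_iff two_ne_zero |>.1 h
  rw [← sum_dotProduct_eigenvectorBasis_smul hH v]
  exact Finset.sum_eq_zero fun i _ ↦ by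
    change (v ⬝ᵥ b i) • b i = 0
    rw [hci i, zero_smul]

/-- **The signed version for the application**: with `T` symmetric non-degenerate and a minority
vector `w` of EITHER sign, the matrix `s • T` with `s = ±1` chosen so that `⟨w, (sT) w⟩ < 0`
has signature `(2, 1)` in the above sense. [cite: Perutz2006, §2.3 (d)] -/
theorem exists_sign_negative_eigenvector_of_minority (hT : T.IsSymm)
    (hnd : ∀ v, T *ᵥ v = 0 → v = 0) {w : Fin 3 → ℝ} (hw : w ⬝ᵥ T *ᵥ w ≠ 0)
    (hcs : ∀ v, (w ⬝ᵥ T *ᵥ w) * (v ⬝ᵥ T *ᵥ v) ≤ (w ⬝ᵥ T *ᵥ v) ^ 2) :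
    ∃ s : ℝ, (s = 1 ∨ s = -1) ∧ w ⬝ᵥ (s • T) *ᵥ w < 0 ∧
      ∃ (n : Fin 3 → ℝ) (lam : ℝ), n ⬝ᵥ n = 1 ∧ (s • T) *ᵥ n = lam • n ∧ lam < 0 ∧
        ∀ v, v ⬝ᵥ n = 0 → v ≠ 0 → 0 < v ⬝ᵥ (s • T) *ᵥ v := by
  have key : ∀ s : ℝ, (s = 1 ∨ s = -1) → w ⬝ᵥ (s • T) *ᵥ w < 0 →
      ∃ (n : Fin 3 → ℝ) (lam : ℝ), n ⬝ᵥ n = 1 ∧ (s • T) *ᵥ n = lam • n ∧ lam < 0 ∧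
        ∀ v, v ⬝ᵥ n = 0 → v ≠ 0 → 0 < v ⬝ᵥ (s • T) *ᵥ v := by
    intro s hs hws
    have hs2 : s * s = 1 := by rcases hs with rfl | rfl <;> norm_num
    refine exists_negative_eigenvector_of_minority (T := s • T) ?_ ?_ hws ?_
    · unfold Matrix.IsSymm; rw [transpose_smul, hT.eq]
    · intro v hv
      refine hnd v ?_
      rw [smul_mulVec] at hv
      have h := congrArg (fun x ↦ s • x) hv
      beta_reduce at h
      rwa [smul_smul, hs2, one_smul, smul_zero] at h
    · intro v
      simp only [smul_mulVec, dotProduct_smul, smul_eq_mul]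
      have h := hcs v
      nlinarith
  rcases lt_or_gt_of_ne hw with hneg | hpos
  · refine ⟨1, Or.inl rfl, by simpa using hneg, key 1 (Or.inl rfl) (by simpa using hneg)⟩
  · have h : w ⬝ᵥ ((-1 : ℝ) • T) *ᵥ w < 0 := by
      rw [smul_mulVec, dotProduct_smul, smul_eq_mul]; linarith
    exact ⟨-1, Or.inr rfl, h, key (-1) (Or.inr rfl) h⟩

end Literature.Analysis.Matrix

end
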